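import Literature.MathematicalPhysics.QuantumFieldTheory.Balaban1983to89.B9Eq324DeltaPrimeATower

/-!
# `Balaban1983to89.B9Eq325GreenPrimeOnProjRange` — T. Bałaban, *Propagators for lattice gauge theories in a background field*, Commun. Math. Phys. **99**
# (1985) 389–434 [Balaban1985BackgroundPropagators] (3.21)–(3.25) p. 394 (*«R = R(U) is an orthogonal projection … onto the subspace ℛ = Δ^η_U N(Q′),
# N(Q′) = {λ : Q′λ = 0}»*, *«Rf = Δ^η_Uλ₀ where λ₀ is a minimum of the function λ ∈ N(Q′) …»*, *«G′ = G′(U) = (Δ′_a)⁻¹»*), with (3.152)–(3.153) p. 426: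
# **`G′_k` ON THE RANGE OF `R_k` IS A GAUGE MODE — `Q̃′_k(G′_kR_kg) = 0` AND `Δ^η_U(G′_kR_kg) = R_kg` EXACTLY (no block term).**
# This is the algebraic reason why STOREY H's covariant Hessian row `H3` (the third word `G̃_kD_UR_kD*_UG̃_k = D_UG′_kR_kG′_kD*_U`, the object
# `u = G′_kω`, `ω = R_kG′_kD*_Uf`) does NOT need a Hessian letter for `G′_k` on ARBITRARY Hölder data (the displayed letter (HLb) of
# `B9Eq3152StoreyHOfHLb`, unsatisfiable for `d ≥ 2` because of the block term `a′Q̃′†Q̃′` of `Δ′`): on `ω ∈ ran R_k` the equation for `u` is the PURE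
# covariant Laplace equation `Δ^η_U u = ω`, to which interior Schauder theory (the `B4Eq19Lattice*` ∕ `B9Eq344LocalGradientFlat` road) applies.
# NE9 crux-team LEAF PROVER 01, gen 95.

statement-level skeleton of published theorems with citation tags; proofs where landed; nothing here is a claim about the Yang–Mills mass gap

CITATION HEADER (lean-in-tree rule).  Audit cell `pub-balaban`, sub-cell `t4`, BINDER row NE9; filed by NE9 crux-team LEAF PROVER 01
(`b2b-balaban-t4-ne9-formalise-leaf-01`, gen 95; bears_on: R4/N22).  Source READ first-hand (`paper:balaban1985-cmp99-background-propagators`, p. 394, p. 426).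
COMPOSED BY NAME: `B11Eq103H1Complex.exists_ker_projR_eq` ((3.22): `Rf = Δ_Uλ₀`, `Q′λ₀ = 0`), `B9Eq326OperatorTower.RofUk` (= `RLatticeK` = `projR`),
`B9Eq324DeltaPrimeATower.GpOfUk_gaugeMode` (`Q̃′λ = 0 → G′_k(Δ^η_Uλ) = λ`), `laplacePrimeAk_apply_of_ker`.  [folklore] bookkeeping of printed identities.

WHAT IS PROVED (sorry-free; proof lane — 0 `def`).
* `exists_gaugeMode_of_RofUk` — `∀ g ∃ λ₀, Q̃′_kλ₀ = 0 ∧ R_kg = Δ^η_Uλ₀ ∧ G′_k(R_kg) = λ₀`.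
* **`QprimeTowerW_GpOfUk_RofUk`** — `Q̃′_k(G′_k(R_kg)) = 0`;  **`covLaplaceSiteK_GpOfUk_RofUk`** — `Δ^η_U(G′_k(R_kg)) = R_kg`;
  `laplacePrimeAk_GpOfUk_RofUk` — `Δ′_{a′,k}(G′_k(R_kg)) = R_kg` (the two coincide on this range).
HONEST SCOPE.  Exact linear algebra of printed identities on the model; no estimate; NOT summit progress (cell pub-balaban: NE9 NOT PRINTED ∕ NOT PROVED; «NE9 ⇐
the named binders»; row WALLED ON A MODEL (O-NE9-1; #5 UNRULED); spine PROVED 0∕9; rung (B)+1 finite T⁴ — NOT infinite volume, NOT mass gap, NOT BetaPertH, NOT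
Clay).  NEW file importing `B9Eq324DeltaPrimeATower`; nothing modified.  Net new unproved facts: 0.
-/

noncomputable section

open scoped InnerProductSpace ComplexConjugate

namespace Literature.MathematicalPhysics.QuantumFieldTheory.Balaban1983to89.B9Eq325GreenPrimeOnProjRange

open B4Sect5Torus (TSite)
open B9SectCLatticeCarrier (Bond)
open B11Eq103H1Complex (SiteL2K covLaplaceSiteK RLatticeK exists_ker_projR_eq apply_greenK)
open B9Eq310HessianOperator (adTransportW)
open B9Eq315QTower (towerP)
open B9Eq326OperatorTower (QprimeTowerW RofUk)
open B9Eq324DeltaPrimeATower (laplacePrimeAk GpOfUk GpOfUk_gaugeMode laplacePrimeAk_apply_of_ker)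

variable {d : ℕ} (L : ℕ) [NeZero L] (m : Fin d → ℕ) [∀ i, NeZero (m i)] (n : ℕ)
  {𝔸 : Type*} [NormedRing 𝔸] [NormedAlgebra ℂ 𝔸] [CompleteSpace 𝔸] [NormOneClass 𝔸]
  {W : Type*} [NormedAddCommGroup W] [InnerProductSpace ℂ W] [FiniteDimensional ℂ W] (φ : W ≃ₗ[ℂ] 𝔸) {c₀ : ℝ} [Fact (0 < c₀)]
  (η : ℝ) (U : Bond d (towerP L m (n + 1)) → 𝔸ˣ) {c₁ : ℝ} [Fact (0 < c₁)] (a' : ℝ)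
  (hpos' : ∀ x : SiteL2K ℂ d (towerP L m (n + 1)) c₀ W, x ≠ 0 → 0 < RCLike.re ⟪x, laplacePrimeAk L m n φ η U a' (c₁ := c₁) x⟫_ℂ)

omit [NormOneClass 𝔸] in
/-- **(3.22) + (3.25): on the range of `R_k`, `G′_k` returns the gauge mode** — for every `g` there is `λ₀` with `Q̃′_kλ₀ = 0`, `R_kg = Δ^η_Uλ₀` and
`G′_k(R_kg) = λ₀`. [cite: Balaban1985BackgroundPropagators, (3.21)–(3.25) p.394] -/
theorem exists_gaugeMode_of_RofUk (g : SiteL2K ℂ d (towerP L m (n + 1)) c₀ W) :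
    ∃ l : SiteL2K ℂ d (towerP L m (n + 1)) c₀ W, QprimeTowerW L m n φ U l = 0 ∧
      RofUk L m n φ η U (c₀ := c₀) g = covLaplaceSiteK ((η : ℂ))⁻¹ (adTransportW φ U) (adTransportW φ fun b => (U b)⁻¹) l ∧
      GpOfUk L m n φ η U a' (c₁ := c₁) hpos' (RofUk L m n φ η U (c₀ := c₀) g) = l := by
  obtain ⟨l, hl, hR⟩ := exists_ker_projR_eq (covLaplaceSiteK ((η : ℂ))⁻¹ (adTransportW φ U) (adTransportW φ fun b => (U b)⁻¹))
    (QprimeTowerW L m n φ U (c₀ := c₀)) g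
  refine ⟨l, hl, hR, ?_⟩
  rw [show RofUk L m n φ η U (c₀ := c₀) g = covLaplaceSiteK ((η : ℂ))⁻¹ (adTransportW φ U) (adTransportW φ fun b => (U b)⁻¹) l from hR]
  exact GpOfUk_gaugeMode L m n φ η U a' hpos' l hl

omit [NormOneClass 𝔸] in
/-- **`Q̃′_k(G′_k(R_kg)) = 0`** — `G′_kR_k` maps into `N(Q̃′_k)`. [cite: Balaban1985BackgroundPropagators, (3.21)–(3.25) p.394, (3.152) p.426] -/
theorem QprimeTowerW_GpOfUk_RofUk (g : SiteL2K ℂ d (towerP L m (n + 1)) c₀ W) :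
    QprimeTowerW L m n φ U (GpOfUk L m n φ η U a' (c₁ := c₁) hpos' (RofUk L m n φ η U (c₀ := c₀) g)) = 0 := by
  obtain ⟨l, hl, -, hG⟩ := exists_gaugeMode_of_RofUk L m n φ η U a' hpos' g
  rw [hG]; exact hl

omit [NormOneClass 𝔸] in
/-- **`Δ^η_U(G′_k(R_kg)) = R_kg` EXACTLY** — on the range of `R_k` the block term of `Δ′_{a′,k} = Δ^η_U + a′Q̃′†Q̃′` is invisible, and `u = G′_kω`
(`ω ∈ ran R_k`) solves the PURE covariant Laplace equation. [cite: Balaban1985BackgroundPropagators, (3.21)–(3.25) p.394, (3.152)–(3.153) p.426] -/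
theorem covLaplaceSiteK_GpOfUk_RofUk (g : SiteL2K ℂ d (towerP L m (n + 1)) c₀ W) :
    covLaplaceSiteK ((η : ℂ))⁻¹ (adTransportW φ U) (adTransportW φ fun b => (U b)⁻¹) (GpOfUk L m n φ η U a' (c₁ := c₁) hpos' (RofUk L m n φ η U (c₀ := c₀) g)) =
      RofUk L m n φ η U (c₀ := c₀) g := by
  obtain ⟨l, -, hR, hG⟩ := exists_gaugeMode_of_RofUk L m n φ η U a' hpos' g
  rw [hG, hR]

omit [NormOneClass 𝔸] in
/-- `Δ′_{a′,k}(G′_k(R_kg)) = R_kg` (trivially, `G′_k = (Δ′_{a′,k})⁻¹`) — together with `covLaplaceSiteK_GpOfUk_RofUk`: the two operators agree on `G′_kR_kg`.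
[cite: Balaban1985BackgroundPropagators, (3.24)–(3.25) p.394] -/
theorem laplacePrimeAk_GpOfUk_RofUk (g : SiteL2K ℂ d (towerP L m (n + 1)) c₀ W) :
    laplacePrimeAk L m n φ η U a' (c₁ := c₁) (GpOfUk L m n φ η U a' (c₁ := c₁) hpos' (RofUk L m n φ η U (c₀ := c₀) g)) = RofUk L m n φ η U (c₀ := c₀) g := by
  rw [GpOfUk, apply_greenK]

end Literature.MathematicalPhysics.QuantumFieldTheory.Balaban1983to89.B9Eq325GreenPrimeOnProjRange

end
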